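import Mathlib

/-!
# The `p`-umbrella `x^p + y z^p` in characteristic `p`: translation homogeneity and the curve blow-up (pub-rosobs observatory)

Behind a class of pair-stalls of the transplanted point-centred recipes (observatory PATTERNS C14, C24[cg3]; rows W1,
W7) sits the normal form `x^p + Y Z^p` (the `p`-umbrella; `p = 2`: Whitney's umbrella): a stall node `F = u_j · E · g^p`
with `E(u_j)` a unit and `g` a polynomial whose linear part involves another variable becomes `x^p + Y Z^p` in the
étale polynomial coordinates `Y = u_j E`, `Z = g`.  Two elementary facts, recorded as ring identities (derived here):

* (U1) TRANSLATION HOMOGENEITY in characteristic `p`: for every `c`, `x^p + (Y + c^p) Z^p = (x + c Z)^p + Y Z^p`, so over a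
  perfect field all closed points of the singular line `{x = Z = 0}` have isomorphic complete local rings — the origin
  is NOT a distinguished "pinch point" (contrast: characteristic `0`);
* (U2) ONE BLOW-UP OF THE LINE `(x, Z)` RESOLVES: in the chart `x = x₁ Z` the total transform is `Z^p · (x₁^p + Y)` and the
  strict transform `x₁^p + Y` is smooth (its `Y`-derivative is `1`); in the chart `Z = z₁ x` the total transform is
  `x^p · (1 + Y z₁^p)` with smooth strict transform.  For `p = 2` in characteristic `0` both the loop of the
  worst-point blow-up and the cure by blowing up the singular line are the textbook example
  [Kollar2007, Ex. 3.6.1]; (U1) adds that in characteristic `p` no finer invariant can even see the origin.  Hence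
  loops of POINT-centred recipes at such nodes are artefacts of the centre's dimension, not obstructions to
  resolution (cf. the permissible-centre algorithms of
  [CossartJannsenSaito2020, Thm. 1.3] — canonical embedded resolution in dimension ≤ 2 by permissible centres).

* (U4) `chart_u_monomial`: `(x₁u)^p + L(u^(b+1)h)^p = u^p(x₁^p + L(u^b h)^p)` — the induction step resolving the
  monomial-umbrella classes U / Uₐ / higher-monomial by blow-ups of smooth centres `{x = u_i = 0}`.
* (U3) for ANY factorised node `F = L·g^p` in characteristic `p`: `∂_i(g^p) = 0`, `∂_i(L g^p) = (∂_i L) g^p`,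
  `∂_i(x^p + L g^p) = (∂_i L) g^p` (`MvPolynomial.pderiv`), so `x^p + F` is singular along all of `{x = g = 0}`.

Identities in a commutative ring (U2) resp. a commutative ring of characteristic `p` (U1, U3); no statement about any
resolution algorithm is made beyond the docstrings. (derived here) [folklore]
-/

namespace Literature.AlgebraicGeometry.Resolution.WeightedBlowup.Umbrella

/-- (U1) translation homogeneity of the `p`-umbrella along its singular line, characteristic `p`:
`x^p + (Y + c^p) Z^p = (x + c Z)^p + Y Z^p`. (derived here) [folklore] -/
theorem translate_along_line {R : Type*} [CommRing R] (p : ℕ) [Fact p.Prime] [CharP R p] (x Y Z c : R) :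
    x ^ p + (Y + c ^ p) * Z ^ p = (x + c * Z) ^ p + Y * Z ^ p := by
  rw [add_pow_char x (c * Z) p, mul_pow]
  ring

/-- (U2, chart `x = x₁ Z`) the total transform of `x^p + Y Z^p` under `x ↦ x₁ Z` is `Z^p (x₁^p + Y)`. (derived here) [folklore] -/
theorem chart_Z {R : Type*} [CommRing R] (p : ℕ) (x₁ Y Z : R) :
    (x₁ * Z) ^ p + Y * Z ^ p = Z ^ p * (x₁ ^ p + Y) := by
  ring

/-- (U2, chart `Z = z₁ x`) the total transform under `Z ↦ z₁ x` is `x^p (1 + Y z₁^p)`. (derived here) [folklore] -/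
theorem chart_x {R : Type*} [CommRing R] (p : ℕ) (x Y z₁ : R) :
    x ^ p + Y * (z₁ * x) ^ p = x ^ p * (1 + Y * z₁ ^ p) := by
  ring

/-- (U2, smoothness of the strict transform in the `Z`-chart) as a polynomial in the variables `x₁ ↦ 0`, `Y ↦ 1`
(and any others), `x₁^p + Y` has `Y`-partial derivative `1`; recorded for `MvPolynomial (Fin 2) ℤ`
(`X 0 = x₁`, `X 1 = Y`). (derived here) [folklore] -/
theorem strictTransform_pderiv_Y (p : ℕ) :
    MvPolynomial.pderiv 1 ((MvPolynomial.X 0 : MvPolynomial (Fin 2) ℤ) ^ p + MvPolynomial.X 1) = 1 := by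
  simp [map_add, MvPolynomial.pderiv_X]

/-- (A, the cusp cylinder) the same chart identity for `x^p + v^{p+1}` under `x ↦ x₁ v`: total transform
`v^p (x₁^p + v)`, strict transform `x₁^p + v` smooth (`v`-derivative `1`) — one blow-up of the singular line lowers
the multiplicity `p+1 ↦ 1` of the `v`-term; the plane cusp needs its usual finite sequence, the cylinder follows it.
(derived here) [folklore] -/
theorem cusp_chart_v {R : Type*} [CommRing R] (p : ℕ) (x₁ v : R) :
    (x₁ * v) ^ p + v ^ (p + 1) = v ^ p * (x₁ ^ p + v) := by
  ring

/-! ## Iterated / monomial umbrellas `x^p + Y·(u_i^b · g')^p`: the `u_i`-chart of the blow-up of `{x = u_i = 0}` -/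

/-- Blow-up of the smooth centre `{x = u = 0}` for a node `x^p + L·(u^b·h)^p` (`b ≥ 1`; `L`, `h` untouched by the chart
substitution `x = x₁·u`): the total transform is `u^p · (x₁^p + L·(u^(b-1)·h)^p)` — the exponent of `u` in the `p`-th
power drops by one and nothing else changes.  Induction on the total degree of the monomial `g` (classes U = one step,
Uₐ = `a` steps, 'higher-monomial' = `Σ b_i` steps) ends at `x₁^p + L·h^p` with `h` a unit, i.e. a smooth hypersurface
(`∂_Y` of `x^p + Y` is `1`, `strictTransform_pderiv_Y`). (derived here) [folklore] -/
theorem chart_u_monomial {R : Type*} [CommRing R] (x₁ L u h : R) (p b : ℕ) :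
    (x₁ * u) ^ p + L * (u ^ (b + 1) * h) ^ p = u ^ p * (x₁ ^ p + L * (u ^ b * h) ^ p) := by
  ring

/-! ## Singular locus of a factorised node (classes A, U, higher of the observatory): `F = L·g^p` -/

/-- In characteristic `p` the partial derivatives of a `p`-th power vanish: `∂_i (g^p) = 0`. (derived here) [folklore] -/
theorem pderiv_pow_char_eq_zero {σ K : Type*} [CommRing K] (p : ℕ) [Fact p.Prime] [CharP K p]
    (i : σ) (g : MvPolynomial σ K) : MvPolynomial.pderiv i (g ^ p) = 0 := by
  rw [MvPolynomial.pderiv_pow]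
  simp

/-- Hence for a node `F = L · g^p` (every class-A / class-U / class-higher node of the observatory's classifier,
with `L` absorbing the unit) EVERY partial derivative of `F` is divisible by `g^p`:
`∂_i (L·g^p) = (∂_i L)·g^p`.  Consequently all partials of `x^p + F` vanish on `{g = 0}`, and since `F ∈ (g)` the
hypersurface `x^p + F = 0` is singular along the whole of `{x = 0, g = 0}` — the codimension-one locus the
POINT-centred recipes do not blow up. (derived here) [folklore] -/
theorem pderiv_mul_pow_char {σ K : Type*} [CommRing K] (p : ℕ) [Fact p.Prime] [CharP K p]
    (i : σ) (L g : MvPolynomial σ K) :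
    MvPolynomial.pderiv i (L * g ^ p) = MvPolynomial.pderiv i L * g ^ p := by
  rw [MvPolynomial.pderiv_mul, pderiv_pow_char_eq_zero p i g, mul_zero, add_zero]

/-- The same with the variable `x` adjoined: for `P = x^p + L·g^p` (in any polynomial ring of characteristic `p`
containing `x`, `L`, `g`), `∂_i P = (∂_i L)·g^p` for every `i` — including `i = x` when `L`, `g` do not involve `x`
(then `∂_x L = 0`). (derived here) [folklore] -/
theorem pderiv_node_char {σ K : Type*} [CommRing K] (p : ℕ) [Fact p.Prime] [CharP K p]
    (i : σ) (x L g : MvPolynomial σ K) :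
    MvPolynomial.pderiv i (x ^ p + L * g ^ p) = MvPolynomial.pderiv i L * g ^ p := by
  rw [map_add, pderiv_pow_char_eq_zero p i x, zero_add, pderiv_mul_pow_char p i L g]

end Literature.AlgebraicGeometry.Resolution.WeightedBlowup.Umbrella
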